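import Summits.PneNP.PneNP.Theorems.PstarPairPeelFPMachine

/-!
# F4-FP, part 2/3: the hub pairing is a largest pairing; correctness of the pair-peeling machine

Cell pnp-ideate, ROUND-18 notes §F4.  Two facts about the machine `ppStr f₀` of part 1:

* `card_pairing_le`: EVERY `PstarPairPeel.Pairing I M` has `M ≤` the number of non-hub outputs (= the size of the
  hub pairing).  Proof: send each hub `h` to a member of its XOR-slot class that is NOT a first component — the second
  component of a pair whose first component lies in the class if there is one (pairs stay inside a class: both
  components read the same XOR slots), else `h` itself; this is injective (the image stays in the class of `h`), so
  `#hubs ≤ m − M`, i.e. `M ≤ m − #hubs = #non-hubs`.  Hence the support item's constant can be taken `C' = C₀`.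
* `ppStr_correct`: the printed string IS `PstarPairPeel.lift (hubPairing I) z` for `z` = the first bits of `f₀` on
  the code of `peel I (hubPairing I)` (hubs get `false`, the `i`-th non-hub gets `z_i`), so p3's
  `lift_not_mem_range` and the hypothesis on `f₀` (all derived tables are `IP₂`, sign-degree `≤ 2`;
  `C₀·n ≤ M ≤ #non-hubs`) put it outside `Range(I)`.

Restricted-model reduction step; nothing here bears on `P` versus `NP`.
-/

set_option linter.dupNamespace false -- `Summit.PneNP.PneNP.…`: summit = sub-problem name (D-0017 single-conjunct layout)

namespace Summit.PneNP.PneNP.Theorems.PstarPairPeelFP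

open Literature.Computability.Complexity
open Summit.PneNP.PneNP.Theorems.PstarPairPeel (Pairing peel lift lift_fst lift_not_mem_range peel_signDegLE_two)

variable {n m : ℕ}

/-! ## Counting: the hub pairing is a largest pairing -/

/-- The two components of a pair have the same hub (they read the same XOR slots). -/
theorem hubN_fst_eq (I : LocalMap 4 n m) {M : ℕ} (π : Pairing I M) (i : Fin M) : hubN I (π.fst i) = hubN I (π.snd i) :=
  hubN_eq_of_key_eq I (by rw [key_rowOf, key_rowOf, π.vars_zero i, π.vars_one i])

/-- Cardinalities of Boolean filters of `Fin m`, as list lengths. -/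
theorem card_filter_univ_eq_length (p : Fin m → Bool) :
    (Finset.univ.filter fun j => p j = true).card = ((List.finRange m).filter p).length := by
  rw [← List.toFinset_card_of_nodup ((List.nodup_finRange m).filter p), List.toFinset_filter, List.toFinset_finRange]

/-- Non-hubs plus hubs are all outputs. -/
theorem length_fstList_add (I : LocalMap 4 n m) :
    (fstList I).length + (Finset.univ.filter fun j : Fin m => (hubN I j == j.val) = true).card = m := by
  rw [card_filter_univ_eq_length]
  have h := List.length_eq_length_filter_add (l := List.finRange m) (fun j => hubN I j == j.val)
  rw [List.length_finRange] at h
  have e : (List.finRange m).filter (fun x => !(fun j => hubN I j == j.val) x) = fstList I := rfl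
  rw [e] at h
  omega

/-- **Every pairing is at most as large as the hub pairing.** -/
theorem card_pairing_le (I : LocalMap 4 n m) {M : ℕ} (π : Pairing I M) : M ≤ (fstList I).length := by
  classical
  set H : Finset (Fin m) := Finset.univ.filter fun j : Fin m => (hubN I j == j.val) = true with hH
  set F : Finset (Fin m) := Finset.univ.image π.fst with hF
  have hFcard : F.card = M := by
    rw [hF, Finset.card_image_of_injective _ π.fst_injective, Finset.card_univ, Fintype.card_fin]
  have hmemH : ∀ {h}, h ∈ H ↔ hubN I h = h.val := by
    intro h; rw [hH, Finset.mem_filter, beq_iff_eq]; simp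
  -- a non-first-component member of the class of each hub
  let g : Fin m → Fin m := fun h => if hx : ∃ i, hubN I (π.fst i) = h.val then π.snd hx.choose else h
  have hg_class : ∀ h ∈ H, hubN I (g h) = h.val := by
    intro h hh
    by_cases hx : ∃ i, hubN I (π.fst i) = h.val
    · simp only [g, dif_pos hx]; rw [← hubN_fst_eq]; exact hx.choose_spec
    · simp only [g, dif_neg hx]; exact hmemH.1 hh
  have hg_notin : ∀ h ∈ H, g h ∉ F := by
    intro h hh hmem
    rw [hF, Finset.mem_image] at hmem
    obtain ⟨i, -, hi⟩ := hmem
    by_cases hx : ∃ i, hubN I (π.fst i) = h.val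
    · simp only [g, dif_pos hx] at hi; exact π.fst_ne_snd i _ hi
    · simp only [g, dif_neg hx] at hi
      exact hx ⟨i, by rw [hi]; exact hmemH.1 hh⟩
  have hinj : Set.InjOn g H := by
    intro h hh h' hh' e
    have h1 := hg_class h hh
    rw [e, hg_class h' hh'] at h1
    exact Fin.ext h1.symm
  have hmaps : Set.MapsTo g (H : Set (Fin m)) ((Finset.univ \ F : Finset (Fin m)) : Set (Fin m)) := by
    intro h hh
    exact Finset.mem_coe.2 (Finset.mem_sdiff.2 ⟨Finset.mem_univ _, hg_notin h (Finset.mem_coe.1 hh)⟩)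
  have hcard : H.card ≤ (Finset.univ \ F).card := Finset.card_le_card_of_injOn g hmaps hinj
  rw [Finset.card_univ_sdiff, Fintype.card_fin, hFcard] at hcard
  have hlen := length_fstList_add I
  rw [← hH] at hlen
  have hMm : M ≤ m := by rw [← hFcard]; exact (Finset.card_le_univ F).trans (by simp)
  omega

/-! ## Correctness -/

/-- The rank of a non-hub output among the non-hubs. -/
theorem findIdx_fstList (I : LocalMap 4 n m) (i : Fin (fstList I).length) :
    ((fstList I).map Fin.val).findIdx (· == ((fstList I).get i).val) = i.val := by
  have hnd : ((fstList I).map Fin.val).Nodup := (nodup_fstList I).map Fin.val_injective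
  have h := hnd.idxOf_getElem i.val (by rw [List.length_map]; exact i.isLt)
  rw [List.getElem_map] at h
  exact h

/-- **The printed string is the lift** of `f₀`'s answer on the derived instance through the hub pairing. -/
theorem readOut_ppStr_eq_lift (f₀ : List Bool → List Bool) (I : LocalMap 4 n m) :
    readOut m (ppStr f₀ I.encode) =
      lift (hubPairing I) (readOut (fstList I).length (f₀ (peel I (hubPairing I)).encode)) := by
  funext j
  rw [readOut_ppStr]
  by_cases hj : hubN I j = j.val
  · have hb : (hubN I j == j.val) = true := by rw [beq_iff_eq]; exact hj
    rw [hb, Bool.not_true, Bool.false_and]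
    unfold lift
    rw [dif_neg]
    rintro ⟨i, hi⟩
    have hne := hubN_ne_of_mem (List.get_mem (fstList I) i)
    exact hne (by rw [show (fstList I).get i = j from hi]; exact hj)
  · have hb : (hubN I j == j.val) = false := by rw [beq_eq_false_iff_ne]; exact hj
    rw [hb, Bool.not_false, Bool.true_and]
    have hmem : j ∈ fstList I := by
      unfold fstList; rw [List.mem_filter]; exact ⟨List.mem_finRange j, by rw [hb]; rfl⟩
    obtain ⟨i, rfl⟩ := List.get_of_mem hmem
    rw [findIdx_fstList I i]
    exact (lift_fst (hubPairing I) (readOut (fstList I).length (f₀ (peel I (hubPairing I)).encode)) i).symm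

/-- **CORRECTNESS OF THE PAIR-PEELING MACHINE** (relative to the hypothesised sign-degree-2 avoider of locality `4`):
on a `P⋆` instance admitting a pairing of size `≥ C₀·n`, `n ≥ 1`, the machine prints a string outside the range. -/
theorem ppStr_correct {C₀ : ℕ} {f₀ : List Bool → List Bool}
    (hspec : ∀ n m (J : LocalMap 4 n m), (∀ j, SignDegLE 2 (J.table j)) → 0 < n → C₀ * n ≤ m →
      readOut m (f₀ J.encode) ∉ J.range)
    (I : LocalMap 4 n m) (hI : ∀ j, I.table j = xorAndPred) {M : ℕ} (π : Pairing I M) (hM : C₀ * n ≤ M) (hn : 0 < n) :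
    readOut m (ppStr f₀ I.encode) ∉ I.range := by
  have hm' : C₀ * n ≤ (fstList I).length := hM.trans (card_pairing_le I π)
  have hz := hspec n _ (peel I (hubPairing I)) (peel_signDegLE_two I (hubPairing I)) hn hm'
  rw [readOut_ppStr_eq_lift]
  exact lift_not_mem_range I hI (hubPairing I) _ hz

end Summit.PneNP.PneNP.Theorems.PstarPairPeelFP
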